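import Literature.Probability.RandomPlanarGeometry.HullSubdomainPullback
import Literature.Probability.RandomPlanarGeometry.ChordalBoundary
import Literature.Probability.RandomPlanarGeometry.ConformalMapCaratheodoryProofs
import Literature.Probability.RandomPlanarGeometry.JordanDomainProofs
import Literature.Probability.RandomPlanarGeometry.ArcHullDomains
import HarnessLib

/-!
# One-sided pulled-back hulls: recognising `𝒬₊ ∪ 𝒬₋` from the boundary trace of the removed region

Companion of `HullSubdomainPullback` (`IsStarHull.pullbackHull`: hull subdomains `D' ⊆ D` of a Dobrushin
domain `(D; a, b)` pull back, under a chordal uniformizing map `φ : (ℍ; 0, ∞) → (D; a, b)`, to `*`-hulls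
`A = closure (ℍ ∖ φ⁻¹ D')`). The ONE-SIDED restriction vocabulary of

* G. F. Lawler, O. Schramm, W. Werner, *Conformal restriction: the chordal case*, J. Amer. Math. Soc.
  **16** (2003), arXiv:math/0209343, §2 p. 8 (`𝒬₊`, `𝒬₋`: `*`-hulls whose real points are all positive,
  resp. all negative) and §8 (one-sided restriction),

asks, for a concrete subdomain `D'`, whether `A ∈ 𝒬₊ ∪ 𝒬₋`; this is decided here from the geometry of
`D'` inside `D` through Carathéodory's boundary correspondence, with NO orientation input:

* `isPlusHull_or_isMinusHull_pullbackHull` — if the removed region `closure (D ∖ D')` meets `∂D` only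
  inside a closed (pre)connected boundary piece `T ⊆ ∂D` avoiding `a` and `b`, then `A` is a plus-hull
  OR a minus-hull. Proof: by Carathéodory (disc form, PROVED in the tree:
  `JordanDomain.exists_continuousOn_extension_holds`) the extension `Ψ` of `φ ∘ C⁻¹` (`C` the Cayley
  map) is a continuous bijection of the unit circle onto `∂D` with `Ψ(-1) = a`, `Ψ(1) = b`; every real
  point `x` of `A` has `Ψ (C x) ∈ closure (D ∖ D') ∩ ∂D ⊆ T`; the closed set `S = 𝕋 ∩ Ψ⁻¹ T` misses
  `±1`, and if it met both open half-circles then `T = Ψ(S ∩ {im ≤ 0}) ∪ Ψ(S ∩ {im ≥ 0})` would split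
  the preconnected `T` into two disjoint nonempty closed pieces (injectivity of `Ψ` on the circle);
  finally `C` maps `(0, ∞)` into the lower and `(-∞, 0)` into the upper half-circle.

Deliberately NOT here: WHICH side (that needs the orientation of `∂D`, cf. `BoundaryCorrespondence`,
`ChordalBoundary`); hulls whose removed region touches both boundary arcs (two-sided, `IsStarHull` only).

Mathlib: `isPreconnected_closed_iff`, `ContinuousWithinAt.mem_closure_image`, `IsCompact.image_of_continuousOn`;
tree: `cayley`/`cayleyFun`, `JordanDomain.exists_continuousOn_extension_holds` (Pommerenke (1992) Thm. 2.6,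
proved), `JordanDomain.extension_cayleyFun_eq` / `extension_one_eq`, `IsStarHull.pullbackHull`,
`JordanDomain.isSimplyConnected_holds`.
-/

noncomputable section

open Set Filter Metric Complex
open scoped _root_.Topology
open UpperHalfPlane (upperHalfPlaneSet isOpen_upperHalfPlaneSet)

namespace Literature.Probability.RandomPlanarGeometry

/-! ### The Cayley transform on the real axis -/

/-- The imaginary part of `C x = (x - i)/(x + i)` for real `x` is `-2x/(x² + 1)`. [folklore] -/
theorem cayleyFun_ofReal_im (x : ℝ) : (cayleyFun x).im = -2 * x / (x ^ 2 + 1) := by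
  have hn : Complex.normSq ((x : ℂ) + I) = x ^ 2 + 1 := by
    rw [Complex.normSq_apply]
    simp
    ring
  rw [cayleyFun_apply, Complex.div_im, hn]
  simp only [sub_im, ofReal_im, I_im, zero_sub, add_re, ofReal_re, I_re, add_zero, sub_re,
    sub_zero, add_im, zero_add]
  have hden : (x : ℝ) ^ 2 + 1 ≠ 0 := by positivity
  field_simp
  ring

/-- `C` maps the positive reals into the lower half-circle: `im (C x) < 0 ↔ 0 < x`. [folklore] -/
theorem cayleyFun_ofReal_im_neg_iff (x : ℝ) : (cayleyFun x).im < 0 ↔ 0 < x := by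
  have hden : (0 : ℝ) < x ^ 2 + 1 := by positivity
  rw [cayleyFun_ofReal_im, div_neg_iff]
  constructor
  · rintro (⟨_, h⟩ | ⟨h, _⟩)
    · linarith
    · linarith
  · intro h
    exact Or.inr ⟨by linarith, hden⟩

/-- `C` maps the negative reals into the upper half-circle: `0 < im (C x) ↔ x < 0`. [folklore] -/
theorem cayleyFun_ofReal_im_pos_iff (x : ℝ) : 0 < (cayleyFun x).im ↔ x < 0 := by
  have hden : (0 : ℝ) < x ^ 2 + 1 := by positivity
  rw [cayleyFun_ofReal_im, div_pos_iff]
  constructor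
  · rintro (⟨h, _⟩ | ⟨_, h⟩)
    · linarith
    · linarith
  · intro h
    exact Or.inl ⟨by linarith, hden⟩

/-- A point of the unit circle with zero imaginary part is `1` or `-1`. [folklore] -/
theorem eq_one_or_neg_one_of_mem_sphere {u : ℂ} (hu : u ∈ sphere (0 : ℂ) 1) (him : u.im = 0) :
    u = 1 ∨ u = -1 := by
  rw [mem_sphere_zero_iff_norm] at hu
  have h2 : u.re ^ 2 = 1 := by
    have := Complex.sq_norm u
    rw [Complex.normSq_apply, hu, him] at this
    nlinarith
  have hre : u.re = 1 ∨ u.re = -1 := by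
    have h3 : (u.re - 1) * (u.re + 1) = 0 := by nlinarith
    rcases mul_eq_zero.1 h3 with h4 | h4
    · left; linarith
    · right; linarith
  rcases hre with h | h
  · left; exact Complex.ext (by simp [h]) (by simp [him])
  · right; exact Complex.ext (by simp [h]) (by simp [him])

/-! ### Real hull points are traced on the boundary by the Carathéodory extension -/

section Trace

variable {D : DobrushinDomain} {φ : ConformalEquiv upperHalfPlaneSet D.carrier}

/-- **Boundary trace of a real hull point.** If `Ψ` is a continuous extension of `φ ∘ C⁻¹` to the
closed disc and `x ∈ ℝ` lies on the pulled-back hull `closure (ℍ ∖ φ⁻¹ D')`, then `Ψ (C x)` lies in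
`closure (D ∖ D')` (continuity of `Ψ ∘ C` on `ℍ̄`, `Ψ ∘ C = φ` on `ℍ`) and on `∂D` (the circle goes
to `∂D`). [folklore] -/
theorem extension_cayleyFun_mem_of_ofReal_mem_pullbackHull {D' : DobrushinDomain} {Ψ : ℂ → ℂ}
    (hΨc : ContinuousOn Ψ (closedBall 0 1)) (hΨeq : EqOn Ψ (cayley.symm.trans φ) (ball 0 1))
    {x : ℝ} (hx : (x : ℂ) ∈ φ.pullbackHull D') :
    Ψ (cayleyFun x) ∈ closure (D.carrier \ D'.carrier) ∧ Ψ (cayleyFun x) ∈ frontier D.carrier := by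
  set W : Set ℂ := upperHalfPlaneSet \ φ.pullbackDomain D' with hW
  have hxW : (x : ℂ) ∈ closure W := hx
  have hx0 : (0 : ℝ) ≤ (x : ℂ).im := by simp
  -- `Ψ ∘ C` is continuous within `W` at `x`
  have hcts : ContinuousWithinAt (Ψ ∘ cayleyFun) W (x : ℂ) := by
    have h1 : ContinuousWithinAt cayleyFun W (x : ℂ) :=
      ((continuousOn_cayleyFun (x : ℂ) (add_I_ne_zero hx0)).continuousAt
        ((isOpen_ne_fun (continuous_id.add continuous_const) continuous_const).mem_nhds
          (add_I_ne_zero hx0))).continuousWithinAt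
    have hmaps : MapsTo cayleyFun W (closedBall (0 : ℂ) 1) := fun z hz ↦
      mem_closedBall_zero_iff.2 (norm_cayleyFun_le_one (le_of_lt hz.1))
    have h2 : ContinuousWithinAt Ψ (closedBall 0 1) (cayleyFun x) :=
      hΨc _ (mem_closedBall_zero_iff.2 (norm_cayleyFun_ofReal x).le)
    exact h2.comp h1 hmaps
  have hmem : (Ψ ∘ cayleyFun) (x : ℂ) ∈ closure ((Ψ ∘ cayleyFun) '' W) :=
    hcts.mem_closure_image hxW
  -- the image of `W` lies in `D ∖ D'`
  have himg : (Ψ ∘ cayleyFun) '' W ⊆ D.carrier \ D'.carrier := by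
    rintro _ ⟨z, hz, rfl⟩
    have hzH : z ∈ upperHalfPlaneSet := hz.1
    have heq : (Ψ ∘ cayleyFun) z = φ z := (JordanDomain.eqOn_comp_cayleyFun φ hΨeq hzH).symm
    rw [heq]
    exact ⟨φ.mapsTo hzH, fun hD' ↦ hz.2 ⟨hzH, hD'⟩⟩
  exact ⟨closure_mono himg hmem, JordanDomain.mapsTo_frontier_of_extension hΨc hΨeq
    (mem_sphere_zero_iff_norm.2 (norm_cayleyFun_ofReal x))⟩

end Trace

/-! ### One-sidedness from the boundary trace -/

section OneSided

variable {D : DobrushinDomain} {φ : ConformalEquiv upperHalfPlaneSet D.carrier}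

/-- **Key separation step.** Let `Ψ` be continuous on the closed disc, injective on the unit circle
`𝕋` and mapping `𝕋` onto `∂D` with `Ψ (-1) = a`, `Ψ 1 = b`; let `T ⊆ ∂D` be closed and preconnected
with `a, b ∉ T`. Then the closed set `S = 𝕋 ∩ Ψ⁻¹ T` cannot meet both open half-circles
`{im < 0}` and `{im > 0}`: otherwise `T = Ψ (S ∩ {im ≤ 0}) ∪ Ψ (S ∩ {im ≥ 0})` is a splitting of `T`
into two closed nonempty pieces whose intersection lies in `Ψ {±1} = {a, b}`, hence is empty.
[folklore] -/
theorem not_meets_both_halfCircles {Ψ : ℂ → ℂ} (hΨc : ContinuousOn Ψ (closedBall 0 1))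
    (hsph : BijOn Ψ (sphere 0 1) (frontier D.carrier)) (hm1 : Ψ (-1) = D.pt 0) (h1 : Ψ 1 = D.pt 1)
    {T : Set ℂ} (hTc : IsPreconnected T) (hTcl : IsClosed T) (hTf : T ⊆ frontier D.carrier)
    (h0T : D.pt 0 ∉ T) (h1T : D.pt 1 ∉ T) :
    ¬ ((sphere (0 : ℂ) 1 ∩ Ψ ⁻¹' T ∩ {w | w.im < 0}).Nonempty ∧
       (sphere (0 : ℂ) 1 ∩ Ψ ⁻¹' T ∩ {w | 0 < w.im}).Nonempty) := by
  rintro ⟨⟨w₁, hw₁S, hw₁⟩, ⟨w₂, hw₂S, hw₂⟩⟩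
  set S : Set ℂ := sphere (0 : ℂ) 1 ∩ Ψ ⁻¹' T with hS
  have hScl : IsClosed S :=
    (hΨc.mono sphere_subset_closedBall).preimage_isClosed_of_isClosed isClosed_sphere hTcl
  set L : Set ℂ := S ∩ {w | w.im ≤ 0} with hL
  set U : Set ℂ := S ∩ {w | 0 ≤ w.im} with hU
  have hLsub : L ⊆ closedBall (0 : ℂ) 1 := fun w hw ↦ sphere_subset_closedBall hw.1.1
  have hUsub : U ⊆ closedBall (0 : ℂ) 1 := fun w hw ↦ sphere_subset_closedBall hw.1.1
  have hLc : IsCompact L := (isCompact_sphere (0 : ℂ) 1).of_isClosed_subset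
    (hScl.inter (isClosed_le continuous_im continuous_const)) fun w hw ↦ hw.1.1
  have hUc : IsCompact U := (isCompact_sphere (0 : ℂ) 1).of_isClosed_subset
    (hScl.inter (isClosed_le continuous_const continuous_im)) fun w hw ↦ hw.1.1
  have htc : IsClosed (Ψ '' L) := (hLc.image_of_continuousOn (hΨc.mono hLsub)).isClosed
  have ht'c : IsClosed (Ψ '' U) := (hUc.image_of_continuousOn (hΨc.mono hUsub)).isClosed
  -- `T ⊆ Ψ L ∪ Ψ U`
  have hcover : T ⊆ Ψ '' L ∪ Ψ '' U := by
    intro p hp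
    obtain ⟨w, hw, rfl⟩ := hsph.surjOn (hTf hp)
    rcases le_total w.im 0 with hle | hle
    · exact Or.inl ⟨w, ⟨⟨hw, hp⟩, hle⟩, rfl⟩
    · exact Or.inr ⟨w, ⟨⟨hw, hp⟩, hle⟩, rfl⟩
  have hw₁' : w₁.im < 0 := hw₁
  have hw₂' : 0 < w₂.im := hw₂
  have hne₁ : (T ∩ Ψ '' L).Nonempty := ⟨Ψ w₁, hw₁S.2, w₁, ⟨hw₁S, hw₁'.le⟩, rfl⟩
  have hne₂ : (T ∩ Ψ '' U).Nonempty := ⟨Ψ w₂, hw₂S.2, w₂, ⟨hw₂S, hw₂'.le⟩, rfl⟩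
  obtain ⟨p, -, ⟨u, huL, rfl⟩, ⟨v, hvU, huv⟩⟩ :=
    isPreconnected_closed_iff.1 hTc _ _ htc ht'c hcover hne₁ hne₂
  -- injectivity on the circle: `u = v` is a point of the circle with `im = 0`, i.e. `±1`
  have hvu : v = u := hsph.injOn hvU.1.1 huL.1.1 huv
  have him : u.im = 0 := le_antisymm huL.2 (hvu ▸ hvU.2)
  rcases eq_one_or_neg_one_of_mem_sphere huL.1.1 him with rfl | rfl
  · exact h1T (h1 ▸ huL.1.2)
  · exact h0T (hm1 ▸ huL.1.2)

/-- **One-sided pulled-back hulls from the boundary trace.** Let `φ` be a chordal uniformizing map of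
the Dobrushin domain `(D; a, b)` and `D'` a hull subdomain (`MarkedDomain.IsHullSubdomain`). If the
removed region `closure (D ∖ D')` meets `∂D` only inside a closed preconnected set `T ⊆ ∂D` containing
neither `a` nor `b` (e.g. a closed boundary arc off the marked points), then the pulled-back hull
`A = closure (ℍ ∖ φ⁻¹ D')` is a `+`-hull or a `−`-hull: its real points are all positive or all
negative. No orientation convention is needed (hence only the disjunction is asserted).
[cite: LawlerSchrammWerner2003Restriction, §2 p. 8 (±-hulls), transposed] -/
theorem isPlusHull_or_isMinusHull_pullbackHull (hφ : D.IsChordalUniformizing φ)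
    {D' : DobrushinDomain} (hD' : D.IsHullSubdomain D') {T : Set ℂ} (hTc : IsPreconnected T)
    (hTcl : IsClosed T) (hTf : T ⊆ frontier D.carrier) (h0T : D.pt 0 ∉ T) (h1T : D.pt 1 ∉ T)
    (htr : closure (D.carrier \ D'.carrier) ∩ frontier D.carrier ⊆ T) :
    IsPlusHull (φ.pullbackHull D') ∨ IsMinusHull (φ.pullbackHull D') := by
  have hstar : IsStarHull (φ.pullbackHull D') :=
    IsStarHull.pullbackHull JordanDomain.isSimplyConnected_holds hφ hD'
  obtain ⟨Ψ, hΨc, hΨeq, -, hsph⟩ :=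
    JordanDomain.exists_continuousOn_extension_holds D.toJordanDomain (cayley.symm.trans φ)
  have hm1 : Ψ (-1) = D.pt 0 := by
    rw [← cayleyFun_zero]
    exact JordanDomain.extension_cayleyFun_eq φ hΨc hΨeq (x := 0) (by exact_mod_cast hφ.1)
  have h1 : Ψ 1 = D.pt 1 := JordanDomain.extension_one_eq φ hΨc hΨeq hφ.2
  have key := not_meets_both_halfCircles hΨc hsph hm1 h1 hTc hTcl hTf h0T h1T
  -- every real hull point `x` has `C x ∈ S = 𝕋 ∩ Ψ⁻¹ T`, and `x ≠ 0`
  have hmemS : ∀ x : ℝ, (x : ℂ) ∈ φ.pullbackHull D' →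
      cayleyFun x ∈ sphere (0 : ℂ) 1 ∩ Ψ ⁻¹' T := fun x hx ↦
    ⟨mem_sphere_zero_iff_norm.2 (norm_cayleyFun_ofReal x),
      htr (extension_cayleyFun_mem_of_ofReal_mem_pullbackHull hΨc hΨeq hx)⟩
  have hx0 : ∀ x : ℝ, (x : ℂ) ∈ φ.pullbackHull D' → x ≠ 0 := by
    rintro x hx rfl
    exact hstar.2 (by exact_mod_cast hx)
  by_cases hneg : ∃ x : ℝ, (x : ℂ) ∈ φ.pullbackHull D' ∧ x < 0
  · -- some negative real point: then all real points are negative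
    obtain ⟨x₁, hx₁, hx₁neg⟩ := hneg
    refine Or.inr ⟨hstar, fun x hx ↦ ?_⟩
    rcases lt_trichotomy x 0 with h | h | h
    · exact h
    · exact absurd h (hx0 x hx)
    · exact absurd ⟨⟨cayleyFun x, hmemS x hx, (cayleyFun_ofReal_im_neg_iff x).2 h⟩,
        ⟨cayleyFun x₁, hmemS x₁ hx₁, (cayleyFun_ofReal_im_pos_iff x₁).2 hx₁neg⟩⟩ key
  · -- no negative real point: all real points are positive
    push Not at hneg
    exact Or.inl ⟨hstar, fun x hx ↦ lt_of_le_of_ne (hneg x hx) (hx0 x hx).symm⟩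

end OneSided

end Literature.Probability.RandomPlanarGeometry

end
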